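import Summits.CriticalPhenomena.CardyFormulaZ2.Theorems.CardyFlipRussoVoronoiHubFromSmirnovChainArmCut

/-!
# Stub `hybArm_cases` of line `moebius-exact-delaunay-dilation-ward`
# (crux `VoronoiHubFromSmirnov`, stmt-CriticalPhenomena-6433, route `CardyFlipRusso`)

**Case analysis of a hybrid chain arm by its in-range defective squares** (re-planned S3b-i,
one-arm route, brick B; Benjamini–Schramm, *Conformal invariance of Voronoi percolation*,
Comm. Math. Phys. 197 (1998), §4 and §9 (9.1)).

A chain arm for the hybrid adjacency `adjHyb S u E₁ E₂` around `z` from radius `u` out to `Rfar ≥ R`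
(square side `u`, hybrid steps of length `≤ u`, `400 u < R`) yields one of five alternatives,
according to the set `𝒟` of DEFECTIVE squares (`DefSq`) whose centre lies at distance in
`[98 u, R + 2 u]` from `z` ("in range"):

* `𝒟 = ∅`: a Euclidean arm across `[100 u, R]` (`chainArm_euc_of_noDefSq`);
* two squares of `𝒟` with centres more than `20 u` apart: the fifth alternative (two far-apart
  in-range defective squares);
* otherwise all of `𝒟` lies within `20 u` of one square `j₀ ∈ 𝒟` at distance `d` from `z`, and
  - `d < 278 u`: no defective square in range `[298 u, R + 2 u]`, a Euclidean arm across
    `[300 u, R]`;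
  - `d > R - 178 u`: no defective square in range `[98 u, R - 198 u]`, a Euclidean arm across
    `[100 u, R - 200 u]`;
  - `278 u ≤ d ≤ R - 178 u`: Euclidean arms across `[100 u, d - 40 u]` and `[d + 40 u, R]`.

Pure case analysis on top of the landed cutting lemma; no new definitions.
-/

noncomputable section

namespace Summit.CriticalPhenomena.CardyFormulaZ2.Cruxes.VoronoiHubFromSmirnov.MoebiusExactDelaunayDilationWard

/-- A hybrid-adjacent pair is `E₁`- or `E₂`-adjacent. -/
theorem e1_or_e2_of_adjHyb {S : Set (ℤ × ℤ)} {ℓ : ℝ} {E₁ E₂ : ℂ → ℂ → Prop} {p q : ℂ}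
    (h : adjHyb S ℓ E₁ E₂ p q) : E₁ p q ∨ E₂ p q := by
  by_cases hS : sqIdx ℓ p ∈ S ∨ sqIdx ℓ q ∈ S
  · exact Or.inr (h.1 hS)
  · exact Or.inl (h.2 hS)

/-- A defective square is met by a black nucleus physically in `K`, hence its index lies in any set
`T` containing the square indices of all such nuclei. -/
theorem mem_of_defSq {E₁ E₂ : ℂ → ℂ → Prop} {ℓ : ℝ} {j : ℤ × ℤ} {K : Set ℂ} {δ : ℝ} {b : Set ℂ}
    {T : Finset (ℤ × ℤ)} (hT : ∀ p : ℂ, p ∈ b → (δ : ℂ) * p ∈ K → sqIdx ℓ p ∈ T)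
    (h : DefSq E₁ E₂ ℓ j K δ b) : j ∈ T := by
  obtain ⟨p, q, hp, hq, hpK, hqK, hj, _⟩ := h
  rcases hj with rfl | rfl
  · exact hT p hp hpK
  · exact hT q hq hqK

/-- **S3b-i, brick B: case analysis of a hybrid chain arm.** A hybrid chain arm around `z` from
radius `u` out to `Rfar ≥ R > 400 u` (square side `u`, steps `≤ u` on `E₁ ∨ E₂`, square indices of
black nuclei physically in `K` inside `T`) gives: a Euclidean arm across `[100 u, R]`, or across
`[300 u, R]`, or across `[100 u, R - 200 u]`, or an in-range defective square `j` at distance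
`d ∈ [278 u, R - 178 u]` with Euclidean arms across `[100 u, d - 40 u]` and `[d + 40 u, R]`, or two
in-range defective squares with centres more than `20 u` apart — by the position of the in-range
defective squares and the cutting lemma `chainArm_euc_of_noDefSq`.
(source: BenjaminiSchramm1998 §4, §9 (9.1), square-by-square telescoping form) -/
theorem hybArm_cases : ∀ (S T : Finset (ℤ × ℤ)) (u R Rfar : ℝ) (E₁ E₂ : ℂ → ℂ → Prop) (z : ℂ)
    (K : Set ℂ) (δ : ℝ) (b : Set ℂ), 0 < u → 400 * u < R → R ≤ Rfar →
    ChainArm (adjHyb (↑S : Set (ℤ × ℤ)) u E₁ E₂) z u Rfar K δ b →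
    (∀ p q : ℂ, p ∈ b → q ∈ b → (δ : ℂ) * p ∈ K → (δ : ℂ) * q ∈ K → (E₁ p q ∨ E₂ p q) →
      dist p q ≤ u) →
    (∀ p : ℂ, p ∈ b → (δ : ℂ) * p ∈ K → sqIdx u p ∈ T) →
    ChainArm E₁ z (100 * u) R K δ b ∨ ChainArm E₁ z (300 * u) R K δ b ∨
    ChainArm E₁ z (100 * u) (R - 200 * u) K δ b ∨
    (∃ j ∈ T, DefSq E₁ E₂ u j K δ b ∧ 278 * u ≤ dist (sqCentre u j) z ∧
      dist (sqCentre u j) z ≤ R - 178 * u ∧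
      ChainArm E₁ z (100 * u) (dist (sqCentre u j) z - 40 * u) K δ b ∧
      ChainArm E₁ z (dist (sqCentre u j) z + 40 * u) R K δ b) ∨
    (∃ j ∈ T, ∃ j' ∈ T, DefSq E₁ E₂ u j K δ b ∧ DefSq E₁ E₂ u j' K δ b ∧
      20 * u < dist (sqCentre u j) (sqCentre u j') ∧ 98 * u ≤ dist (sqCentre u j) z ∧
      dist (sqCentre u j) z ≤ R + 2 * u ∧ 98 * u ≤ dist (sqCentre u j') z ∧
      dist (sqCentre u j') z ≤ R + 2 * u) := by
  intro S T u R Rfar E₁ E₂ z K δ b hu hR hRfar hArm hL hT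
  -- step bound for the hybrid adjacency
  have hStep : ∀ p q : ℂ, p ∈ b → q ∈ b → (δ : ℂ) * p ∈ K → (δ : ℂ) * q ∈ K →
      adjHyb (↑S : Set (ℤ × ℤ)) u E₁ E₂ p q → dist p q ≤ u :=
    fun p q hp hq hpK hqK hadj => hL p q hp hq hpK hqK (e1_or_e2_of_adjHyb hadj)
  -- the cutting lemma, specialised to side `u`, step bound `u`, outer radius `Rfar`
  have hCut : ∀ r₁ r₂' : ℝ, u ≤ r₁ → r₁ < r₂' → r₂' ≤ Rfar →
      (∀ j : ℤ × ℤ, r₁ - u - u ≤ dist (sqCentre u j) z → dist (sqCentre u j) z ≤ r₂' + u + u →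
        ¬ DefSq E₁ E₂ u j K δ b) → ChainArm E₁ z r₁ r₂' K δ b :=
    fun r₁ r₂' h1 h2 h3 hnd => chainArm_euc_of_noDefSq (↑S : Set (ℤ × ℤ)) u u E₁ E₂ z u r₁ r₂'
      Rfar K δ b hu hu.le hArm h1 h2 h3 hStep hnd
  -- "in-range defective" squares
  set InR : ℤ × ℤ → Prop := fun j => DefSq E₁ E₂ u j K δ b ∧ 98 * u ≤ dist (sqCentre u j) z ∧
    dist (sqCentre u j) z ≤ R + 2 * u with hInR
  by_cases h0 : ∃ j, InR j
  swap
  · -- Case 0: no in-range defective square ⇒ Euclidean arm across `[100 u, R]`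
    refine Or.inl (hCut (100 * u) R (by linarith) (by linarith) hRfar fun j hlo hhi hD => h0 ?_)
    exact ⟨j, hD, by linarith, by linarith⟩
  by_cases h2 : ∃ j, InR j ∧ ∃ j', InR j' ∧ 20 * u < dist (sqCentre u j) (sqCentre u j')
  · -- Case 2: two far-apart in-range defective squares ⇒ fifth alternative
    obtain ⟨j, ⟨hDj, hloj, hhij⟩, j', ⟨hDj', hloj', hhij'⟩, hfar⟩ := h2
    exact Or.inr (Or.inr (Or.inr (Or.inr ⟨j, mem_of_defSq hT hDj, j', mem_of_defSq hT hDj', hDj,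
      hDj', hfar, hloj, hhij, hloj', hhij'⟩)))
  -- Case 1: all in-range defective squares lie within `20 u` of a fixed one `j₀`
  obtain ⟨j₀, hj₀⟩ := h0
  have hnear : ∀ j, InR j → dist (sqCentre u j) z ≤ dist (sqCentre u j₀) z + 20 * u ∧
      dist (sqCentre u j₀) z - 20 * u ≤ dist (sqCentre u j) z := by
    intro j hj
    have hd : dist (sqCentre u j) (sqCentre u j₀) ≤ 20 * u :=
      not_lt.mp fun hlt => h2 ⟨j, hj, j₀, hj₀, hlt⟩
    have ht₁ := dist_triangle (sqCentre u j) (sqCentre u j₀) z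
    have ht₂ := dist_triangle (sqCentre u j₀) (sqCentre u j) z
    rw [dist_comm (sqCentre u j₀) (sqCentre u j)] at ht₂
    constructor <;> linarith
  obtain ⟨hD₀, hlo₀, hhi₀⟩ := hj₀
  by_cases ha : dist (sqCentre u j₀) z < 278 * u
  · -- Case 1a: Euclidean arm across `[300 u, R]`
    refine Or.inr (Or.inl (hCut (300 * u) R (by linarith) (by linarith) hRfar
      fun j hlo hhi hD => ?_))
    have h := (hnear j ⟨hD, by linarith, by linarith⟩).1
    linarith
  by_cases hb' : R - 178 * u < dist (sqCentre u j₀) z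
  · -- Case 1b: Euclidean arm across `[100 u, R - 200 u]`
    refine Or.inr (Or.inr (Or.inl (hCut (100 * u) (R - 200 * u) (by linarith) (by linarith)
      (by linarith) fun j hlo hhi hD => ?_)))
    have h := (hnear j ⟨hD, by linarith, by linarith⟩).2
    linarith
  -- Case 1c: `278 u ≤ d ≤ R - 178 u`, Euclidean arms on both sides of `j₀`
  push Not at ha hb'
  refine Or.inr (Or.inr (Or.inr (Or.inl ⟨j₀, mem_of_defSq hT hD₀, hD₀, ha, hb', ?_, ?_⟩)))
  · refine hCut (100 * u) (dist (sqCentre u j₀) z - 40 * u) (by linarith) (by linarith)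
      (by linarith) fun j hlo hhi hD => ?_
    have h := (hnear j ⟨hD, by linarith, by linarith⟩).2
    linarith
  · refine hCut (dist (sqCentre u j₀) z + 40 * u) R (by linarith) (by linarith) hRfar
      fun j hlo hhi hD => ?_
    have h := (hnear j ⟨hD, by linarith, by linarith⟩).1
    linarith

end Summit.CriticalPhenomena.CardyFormulaZ2.Cruxes.VoronoiHubFromSmirnov.MoebiusExactDelaunayDilationWard

end
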